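import Literature.MathematicalPhysics.QuantumLattice.SchwingerOSAxioms
import Literature.MathematicalPhysics.QuantumLattice.OSPolynomialPositivity
import Literature.MathematicalPhysics.QuantumLattice.SchwartzTensorDensity
import HarnessLib

/-!
# Reflection positivity E2 of the Schwinger functions of an OS measure

Trunk **T-AQFT** (topic `MathematicalPhysics/QuantumLattice`), families `constructive-qft`,
`crit-ising`; part of the decomposition of the bridge `Literature.MathematicalPhysics.QuantumLattice.IsOSMeasure.exists_isOSFamily`
/ `exists_isOSFamily'` (measure-form OS axioms ⇒ distributional OS axioms).

The named fact `IsSchwingerFamilyOf.isOSReflectionPositive` (`SchwingerOSAxioms`) asserts: if `S`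
is the Schwinger family of a probability measure `μ` on `𝒮'(ℝ^d)` satisfying OS0 (moments) and
OS3 (reflection positivity on the exponentials `∑ⱼ cⱼ e^{iφ(fⱼ)}`, `fⱼ` positive-time; Glimm–Jaffe
(6.1.4)/(6.1.6)), then `S` satisfies the distributional reflection positivity E2 of
Osterwalder–Schrader, `∑ₙₘ 𝔖ₙ₊ₘ(ΘFₙ* ⊗ Fₘ) ≥ 0` for positive-time `n`-point test functions `Fₙ`
(the tree's `SchwingerFamily.IsOSReflectionPositive`, OS 1973 (4.2)/(E2) with unordered supports).
This file proves it *modulo the density of positive-time tensor products*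
(`IsPositiveTimeMulti.mem_closure_span_positiveTensorProducts`, `SchwartzTensorDensity`):

`IsSchwingerFamilyOf.isOSReflectionPositive_of_closure : D₊ → IsSchwingerFamilyOf.isOSReflectionPositive`.

Route (Glimm–Jaffe §6.1, (6.1.8) `⟨θA, A⟩ ≥ 0` for `A ∈ 𝓔₊` and Prop. 6.1.4; OS 1973 §4.1
(4.3)): the OS form `(F₀, …, F_N) ↦ ∑ₙₘ 𝔖ₙ₊ₘ(ΘFₙ* ⊗ Fₘ)` (`SchwingerFamily.osPairing`) is jointly
continuous on `∏ₙ 𝓢((ℝ^d)ⁿ)` (`tendsto_osPairing`, from the joint continuity of `⊗`,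
`SchwartzMap.tendsto_appendTensor`, and of the OS adjoint) and, on tuples of finite combinations
of positive-time real tensor products, equals `∫ conj(A(θω)) A(ω) dμ ≥ 0` for a field polynomial
`A` (`sum_sum_osPairing_nonneg`, i.e. OS3 on polynomials,
`IsOS3ReflectionPositive.fieldPolynomial_nonneg` of `OSPolynomialPositivity`); by density and
closedness of `[0, ∞) ⊆ ℂ` it is nonnegative on all tuples of positive-time test functions.

Contents: `SchwartzMap.mulCompBound` (the explicit constant of Mathlib's estimate behind
`SchwartzMap.mulComp`, in the `SchwartzMap` namespace next to the tree's `SchwartzMap.mulComp`,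
`SchwartzMap.appendTensor` — a deliberate dot-notation extension), seminorm bounds and joint
continuity of `appendTensor`; tensor identities for `osAdjoint`; the OS pairing and its
continuity; integrability of field monomials; the positivity theorem.

## Sources

* J. Glimm, A. Jaffe, *Quantum Physics: a functional integral point of view*, 2nd ed. (1987),
  §6.1: (6.1.4), (6.1.6), (6.1.8), Prop. 6.1.4 (p. 90). [GlimmJaffeQP1987]
* K. Osterwalder, R. Schrader, *Axioms for Euclidean Green's functions*, Comm. Math. Phys. 31
  (1973) 83–112, §3 (E2), §4.1 (4.3). [OsterwalderSchraderCMP1973]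

## Mathlib

Used: `SchwartzMap.seminorm_le_bound`, `norm_iteratedFDeriv_mul_le`,
`ContinuousLinearMap.iteratedFDeriv_comp_right`, `WithSeminorms.continuous_seminorm`,
`WithSeminorms.tendsto_nhds`, `closure_pi_set`, `IsClosed.closure_subset_iff`. Searched and absent
at the pin: continuity of tensor products of Schwartz functions (`SchwartzMap` has `mulComp`-type
constructions only through the tree's `SchwartzTensor`).
-/

open scoped SchwartzMap ComplexConjugate
open MeasureTheory Filter Topology Complex

noncomputable section

namespace SchwartzMap

section MulCompBound

variable {𝕜 : Type*} [RCLike 𝕜]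
variable {D E₁ E₂ : Type*} [NormedAddCommGroup D] [NormedSpace ℝ D]
  [NormedAddCommGroup E₁] [NormedSpace ℝ E₁] [NormedAddCommGroup E₂] [NormedSpace ℝ E₂]

/-- The explicit constant of the key estimate `decay_mul_comp` (Leibniz rule + chain rule):
`|C₀|^k ∑ᵢ (n choose i) ‖π₁‖ⁱ ‖π₂‖ⁿ⁻ⁱ (‖f‖_{k,i} ‖g‖_{0,n-i} + ‖f‖_{0,i} ‖g‖_{k,n-i})`, a finite
combination of products of Schwartz seminorms of `f` and `g` (OS 1973 §2; GJ §6.1). [folklore] -/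
def mulCompBound (π₁ : D →L[ℝ] E₁) (π₂ : D →L[ℝ] E₂) (C₀ : ℝ) (k n : ℕ) (f : 𝓢(E₁, 𝕜))
    (g : 𝓢(E₂, 𝕜)) : ℝ :=
  |C₀| ^ k * ∑ i ∈ Finset.range (n + 1), (n.choose i : ℝ) * (‖π₁‖ ^ i * ‖π₂‖ ^ (n - i)) *
    (SchwartzMap.seminorm ℝ k i f * SchwartzMap.seminorm ℝ 0 (n - i) g
      + SchwartzMap.seminorm ℝ 0 i f * SchwartzMap.seminorm ℝ k (n - i) g)

/-- `mulCompBound` is nonnegative. [folklore] -/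
theorem mulCompBound_nonneg (π₁ : D →L[ℝ] E₁) (π₂ : D →L[ℝ] E₂) (C₀ : ℝ) (k n : ℕ)
    (f : 𝓢(E₁, 𝕜)) (g : 𝓢(E₂, 𝕜)) : 0 ≤ mulCompBound π₁ π₂ C₀ k n f g := by
  unfold mulCompBound
  refine mul_nonneg (pow_nonneg (abs_nonneg _) _) (Finset.sum_nonneg fun i _ => ?_)
  refine mul_nonneg (mul_nonneg (Nat.cast_nonneg _) (by positivity)) (add_nonneg ?_ ?_) <;>
    exact mul_nonneg (apply_nonneg _ _) (apply_nonneg _ _)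

/-- `mulCompBound` vanishes when the first function does. [folklore] -/
@[simp]
theorem mulCompBound_zero_left (π₁ : D →L[ℝ] E₁) (π₂ : D →L[ℝ] E₂) (C₀ : ℝ) (k n : ℕ)
    (g : 𝓢(E₂, 𝕜)) : mulCompBound π₁ π₂ C₀ k n (0 : 𝓢(E₁, 𝕜)) g = 0 := by
  simp [mulCompBound]

/-- `mulCompBound` vanishes when the second function does. [folklore] -/
@[simp]
theorem mulCompBound_zero_right (π₁ : D →L[ℝ] E₁) (π₂ : D →L[ℝ] E₂) (C₀ : ℝ) (k n : ℕ)
    (f : 𝓢(E₁, 𝕜)) : mulCompBound π₁ π₂ C₀ k n f (0 : 𝓢(E₂, 𝕜)) = 0 := by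
  simp [mulCompBound]

/-- `mulCompBound` is a (jointly) continuous function of `(f, g)`: it is a polynomial in finitely
many Schwartz seminorms, each continuous for the Schwartz topology
(`WithSeminorms.continuous_seminorm`). [folklore] -/
theorem continuous_mulCompBound (π₁ : D →L[ℝ] E₁) (π₂ : D →L[ℝ] E₂) (C₀ : ℝ) (k n : ℕ) :
    Continuous fun fg : 𝓢(E₁, 𝕜) × 𝓢(E₂, 𝕜) => mulCompBound π₁ π₂ C₀ k n fg.1 fg.2 := by
  have h₁ : ∀ a b : ℕ, Continuous fun f : 𝓢(E₁, 𝕜) => SchwartzMap.seminorm ℝ a b f :=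
    fun a b => (schwartz_withSeminorms ℝ E₁ 𝕜).continuous_seminorm (a, b)
  have h₂ : ∀ a b : ℕ, Continuous fun g : 𝓢(E₂, 𝕜) => SchwartzMap.seminorm ℝ a b g :=
    fun a b => (schwartz_withSeminorms ℝ E₂ 𝕜).continuous_seminorm (a, b)
  unfold mulCompBound
  refine continuous_const.mul (continuous_finsetSum _ fun i _ => continuous_const.mul ?_)
  exact (((h₁ k i).comp continuous_fst).mul ((h₂ 0 (n - i)).comp continuous_snd)).add
    (((h₁ 0 i).comp continuous_fst).mul ((h₂ k (n - i)).comp continuous_snd))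

/-- The key estimate `decay_mul_comp` with its explicit constant `mulCompBound`:
`‖x‖^k ‖Dⁿ(f ∘ π₁ · g ∘ π₂)(x)‖ ≤ mulCompBound π₁ π₂ C₀ k n f g` (Leibniz rule
`norm_iteratedFDeriv_mul_le`, chain rule `ContinuousLinearMap.iteratedFDeriv_comp_right`,
`SchwartzMap.le_seminorm`; OS 1973 §2). [folklore] -/
theorem decay_mul_comp_le (f : 𝓢(E₁, 𝕜)) (g : 𝓢(E₂, 𝕜)) (π₁ : D →L[ℝ] E₁) (π₂ : D →L[ℝ] E₂)
    {C₀ : ℝ} (hC : ∀ x, ‖x‖ ≤ C₀ * max ‖π₁ x‖ ‖π₂ x‖) (k n : ℕ) (x : D) :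
    ‖x‖ ^ k * ‖iteratedFDeriv ℝ n (fun x => f (π₁ x) * g (π₂ x)) x‖ ≤
      mulCompBound π₁ π₂ C₀ k n f g := by
  have hf : ContDiff ℝ ((⊤ : ℕ∞) : WithTop ℕ∞) (fun x => f (π₁ x)) := (f.smooth ⊤).comp π₁.contDiff
  have hg : ContDiff ℝ ((⊤ : ℕ∞) : WithTop ℕ∞) (fun x => g (π₂ x)) := (g.smooth ⊤).comp π₂.contDiff
  have h1 : ∀ i, ‖iteratedFDeriv ℝ i (fun x => f (π₁ x)) x‖
      ≤ ‖iteratedFDeriv ℝ i f (π₁ x)‖ * ‖π₁‖ ^ i := by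
    intro i
    rw [show (fun x => f (π₁ x)) = f ∘ π₁ from rfl,
      π₁.iteratedFDeriv_comp_right (f.smooth ⊤) x (i := i) (mod_cast le_top)]
    refine (ContinuousMultilinearMap.norm_compContinuousLinearMap_le _ _).trans ?_
    simp
  have h2 : ∀ i, ‖iteratedFDeriv ℝ i (fun x => g (π₂ x)) x‖
      ≤ ‖iteratedFDeriv ℝ i g (π₂ x)‖ * ‖π₂‖ ^ i := by
    intro i
    rw [show (fun x => g (π₂ x)) = g ∘ π₂ from rfl,
      π₂.iteratedFDeriv_comp_right (g.smooth ⊤) x (i := i) (mod_cast le_top)]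
    refine (ContinuousMultilinearMap.norm_compContinuousLinearMap_le _ _).trans ?_
    simp
  have hx : ‖x‖ ^ k ≤ |C₀| ^ k * (‖π₁ x‖ ^ k + ‖π₂ x‖ ^ k) := by
    have h : ‖x‖ ≤ |C₀| * max ‖π₁ x‖ ‖π₂ x‖ :=
      (hC x).trans (mul_le_mul_of_nonneg_right (le_abs_self _) (by positivity))
    have hm : (max ‖π₁ x‖ ‖π₂ x‖) ^ k ≤ ‖π₁ x‖ ^ k + ‖π₂ x‖ ^ k := by
      rcases le_total ‖π₁ x‖ ‖π₂ x‖ with h' | h'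
      · rw [max_eq_right h']; exact le_add_of_nonneg_left (by positivity)
      · rw [max_eq_left h']; exact le_add_of_nonneg_right (by positivity)
    calc ‖x‖ ^ k ≤ (|C₀| * max ‖π₁ x‖ ‖π₂ x‖) ^ k := pow_le_pow_left₀ (norm_nonneg _) h k
      _ = |C₀| ^ k * (max ‖π₁ x‖ ‖π₂ x‖) ^ k := mul_pow _ _ _
      _ ≤ |C₀| ^ k * (‖π₁ x‖ ^ k + ‖π₂ x‖ ^ k) := by gcongr
  have hs₁ : ∀ i, 0 ≤ SchwartzMap.seminorm ℝ k i f := fun i => apply_nonneg _ _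
  have hs₂ : ∀ i, 0 ≤ SchwartzMap.seminorm ℝ 0 i f := fun i => apply_nonneg _ _
  have hs₃ : ∀ i, 0 ≤ SchwartzMap.seminorm ℝ k i g := fun i => apply_nonneg _ _
  have hs₄ : ∀ i, 0 ≤ SchwartzMap.seminorm ℝ 0 i g := fun i => apply_nonneg _ _
  calc ‖x‖ ^ k * ‖iteratedFDeriv ℝ n (fun x => f (π₁ x) * g (π₂ x)) x‖
      ≤ (|C₀| ^ k * (‖π₁ x‖ ^ k + ‖π₂ x‖ ^ k)) * ∑ i ∈ Finset.range (n + 1), (n.choose i : ℝ)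
          * ‖iteratedFDeriv ℝ i (fun x => f (π₁ x)) x‖
          * ‖iteratedFDeriv ℝ (n - i) (fun x => g (π₂ x)) x‖ := by
        gcongr
        exact norm_iteratedFDeriv_mul_le hf hg x (mod_cast le_top)
    _ ≤ (|C₀| ^ k * (‖π₁ x‖ ^ k + ‖π₂ x‖ ^ k)) * ∑ i ∈ Finset.range (n + 1), (n.choose i : ℝ)
          * (‖iteratedFDeriv ℝ i f (π₁ x)‖ * ‖π₁‖ ^ i)
          * (‖iteratedFDeriv ℝ (n - i) g (π₂ x)‖ * ‖π₂‖ ^ (n - i)) := by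
        gcongr with i hi
        · exact h1 i
        · exact h2 (n - i)
    _ = |C₀| ^ k * ∑ i ∈ Finset.range (n + 1), (n.choose i : ℝ) * (‖π₁‖ ^ i * ‖π₂‖ ^ (n - i)) *
          ((‖π₁ x‖ ^ k * ‖iteratedFDeriv ℝ i f (π₁ x)‖) * ‖iteratedFDeriv ℝ (n - i) g (π₂ x)‖
            + ‖iteratedFDeriv ℝ i f (π₁ x)‖
              * (‖π₂ x‖ ^ k * ‖iteratedFDeriv ℝ (n - i) g (π₂ x)‖)) := by
        rw [mul_assoc, Finset.mul_sum, Finset.mul_sum, Finset.mul_sum]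
        refine Finset.sum_congr rfl fun i _ => ?_
        ring
    _ ≤ _ := by
        unfold mulCompBound
        gcongr with i hi
        · exact le_seminorm ℝ k i f _
        · exact norm_iteratedFDeriv_le_seminorm ℝ g _ _
        · exact norm_iteratedFDeriv_le_seminorm ℝ f _ _
        · exact le_seminorm ℝ k _ g _

/-- Seminorm bound for `mulComp`: `‖mulComp f g π₁ π₂ h‖_{k,n} ≤ mulCompBound π₁ π₂ C₀ k n f g` for
any admissible constant `C₀`. [folklore] -/
theorem seminorm_mulComp_le (f : 𝓢(E₁, 𝕜)) (g : 𝓢(E₂, 𝕜)) (π₁ : D →L[ℝ] E₁) (π₂ : D →L[ℝ] E₂)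
    (h : ∃ C₀ : ℝ, ∀ x, ‖x‖ ≤ C₀ * max ‖π₁ x‖ ‖π₂ x‖) {C₀ : ℝ}
    (hC : ∀ x, ‖x‖ ≤ C₀ * max ‖π₁ x‖ ‖π₂ x‖) (k n : ℕ) :
    SchwartzMap.seminorm 𝕜 k n (mulComp f g π₁ π₂ h) ≤ mulCompBound π₁ π₂ C₀ k n f g :=
  seminorm_le_bound 𝕜 k n _ (mulCompBound_nonneg π₁ π₂ C₀ k n f g)
    fun x => decay_mul_comp_le f g π₁ π₂ hC k n x

end MulCompBound

section AppendTensor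

variable {𝕜 : Type*} [RCLike 𝕜]
variable {E : Type*} [NormedAddCommGroup E] [NormedSpace ℝ E]
variable {n m : ℕ}

/-- The admissible constant `C₀ = 1` for `appendTensor`: `‖x‖ ≤ max ‖x ∘ castAdd‖ ‖x ∘ natAdd‖`
on `Fin (n + m) → E`. [folklore] -/
theorem norm_le_max_restrict (x : Fin (n + m) → E) :
    ‖x‖ ≤ 1 * max ‖restrictCLM (E := E) (Fin.castAdd m) x‖ ‖restrictCLM (E := E) (Fin.natAdd n) x‖ := by
  rw [one_mul, pi_norm_le_iff_of_nonneg (by positivity)]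
  intro i
  induction i using Fin.addCases with
  | left j => exact (norm_le_pi_norm (x ∘ Fin.castAdd m) j).trans (le_max_left _ _)
  | right j => exact (norm_le_pi_norm (x ∘ Fin.natAdd n) j).trans (le_max_right _ _)

/-- **Seminorm bound for the tensor product** `F ⊗ G` in appended variables:
`‖F ⊗ G‖_{k,l} ≤ mulCompBound (·∘castAdd) (·∘natAdd) 1 k l F G`, a finite combination of products
of seminorms of `F` and `G` (OS 1973 §2: `⊗` is (separately, hence jointly) continuous on `𝒮`). [folklore] -/
theorem seminorm_appendTensor_le (F : 𝓢((Fin n → E), 𝕜)) (G : 𝓢((Fin m → E), 𝕜)) (k l : ℕ) :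
    SchwartzMap.seminorm 𝕜 k l (F.appendTensor G) ≤
      mulCompBound (restrictCLM (E := E) (Fin.castAdd m)) (restrictCLM (E := E) (Fin.natAdd n))
        1 k l F G :=
  seminorm_mulComp_le F G _ _ _ norm_le_max_restrict k l

/-- `appendTensor` is additive in the first factor. [folklore] -/
theorem appendTensor_add_left (F F' : 𝓢((Fin n → E), 𝕜)) (G : 𝓢((Fin m → E), 𝕜)) :
    (F + F').appendTensor G = F.appendTensor G + F'.appendTensor G := by
  ext x; simp [appendTensor_apply, add_mul]

/-- `appendTensor` is additive in the second factor. [folklore] -/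
theorem appendTensor_add_right (F : 𝓢((Fin n → E), 𝕜)) (G G' : 𝓢((Fin m → E), 𝕜)) :
    F.appendTensor (G + G') = F.appendTensor G + F.appendTensor G' := by
  ext x; simp [appendTensor_apply, mul_add]

/-- `appendTensor` is homogeneous in the first factor. [folklore] -/
theorem appendTensor_smul_left (c : 𝕜) (F : 𝓢((Fin n → E), 𝕜)) (G : 𝓢((Fin m → E), 𝕜)) :
    (c • F).appendTensor G = c • F.appendTensor G := by
  ext x; simp [appendTensor_apply, mul_assoc]

/-- `appendTensor` is homogeneous in the second factor. [folklore] -/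
theorem appendTensor_smul_right (c : 𝕜) (F : 𝓢((Fin n → E), 𝕜)) (G : 𝓢((Fin m → E), 𝕜)) :
    F.appendTensor (c • G) = c • F.appendTensor G := by
  ext x; simp [appendTensor_apply, mul_left_comm]

/-- `appendTensor` is subtractive in the first factor. [folklore] -/
theorem appendTensor_sub_left (F F' : 𝓢((Fin n → E), 𝕜)) (G : 𝓢((Fin m → E), 𝕜)) :
    (F - F').appendTensor G = F.appendTensor G - F'.appendTensor G := by
  ext x; simp [appendTensor_apply, sub_mul]

/-- `appendTensor` is subtractive in the second factor. [folklore] -/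
theorem appendTensor_sub_right (F : 𝓢((Fin n → E), 𝕜)) (G G' : 𝓢((Fin m → E), 𝕜)) :
    F.appendTensor (G - G') = F.appendTensor G - F.appendTensor G' := by
  ext x; simp [appendTensor_apply, mul_sub]

/-- `appendTensor` of finite sums in the first factor. [folklore] -/
theorem appendTensor_sum_left {ι : Type*} (s : Finset ι) (F : ι → 𝓢((Fin n → E), 𝕜))
    (G : 𝓢((Fin m → E), 𝕜)) :
    (∑ i ∈ s, F i).appendTensor G = ∑ i ∈ s, (F i).appendTensor G := by
  ext x; simp [appendTensor_apply, Finset.sum_mul]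

/-- `appendTensor` of finite sums in the second factor. [folklore] -/
theorem appendTensor_sum_right {ι : Type*} (s : Finset ι) (F : 𝓢((Fin n → E), 𝕜))
    (G : ι → 𝓢((Fin m → E), 𝕜)) :
    F.appendTensor (∑ i ∈ s, G i) = ∑ i ∈ s, F.appendTensor (G i) := by
  ext x; simp [appendTensor_apply, Finset.mul_sum]

/-- **Joint continuity of the tensor product** (OS 1973 §2): if `P → F` and `Q → G` in `𝒮` along a
filter, then `P ⊗ Q → F ⊗ G` in `𝒮`. From `seminorm_appendTensor_le`, bilinearity
`P ⊗ Q - F ⊗ G = (P - F) ⊗ Q + F ⊗ (Q - G)`, and continuity of `mulCompBound`. [folklore] -/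
theorem tendsto_appendTensor {α : Type*} {l : Filter α} {P : α → 𝓢((Fin n → E), 𝕜)}
    {Q : α → 𝓢((Fin m → E), 𝕜)} {F : 𝓢((Fin n → E), 𝕜)} {G : 𝓢((Fin m → E), 𝕜)}
    (hP : Tendsto P l (𝓝 F)) (hQ : Tendsto Q l (𝓝 G)) :
    Tendsto (fun a => (P a).appendTensor (Q a)) l (𝓝 (F.appendTensor G)) := by
  set π₁ := restrictCLM (E := E) (Fin.castAdd m)
  set π₂ := restrictCLM (E := E) (Fin.natAdd n)
  rw [(schwartz_withSeminorms 𝕜 (Fin (n + m) → E) 𝕜).tendsto_nhds]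
  rintro ⟨k, l'⟩ ε hε
  have hP0 : Tendsto (fun a => P a - F) l (𝓝 0) := tendsto_sub_nhds_zero_iff.2 hP
  have hQ0 : Tendsto (fun a => Q a - G) l (𝓝 0) := tendsto_sub_nhds_zero_iff.2 hQ
  have hB₁ : Tendsto (fun a => mulCompBound π₁ π₂ 1 k l' (P a - F) (Q a)) l (𝓝 0) := by
    have h := ((continuous_mulCompBound (𝕜 := 𝕜) π₁ π₂ 1 k l').tendsto ((0 : 𝓢((Fin n → E), 𝕜)), G)).comp
      (hP0.prodMk_nhds hQ)
    simpa [Function.comp_def] using h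
  have hB₂ : Tendsto (fun a => mulCompBound π₁ π₂ 1 k l' F (Q a - G)) l (𝓝 0) := by
    have h := ((continuous_mulCompBound (𝕜 := 𝕜) π₁ π₂ 1 k l').tendsto (F, (0 : 𝓢((Fin m → E), 𝕜)))).comp
      (tendsto_const_nhds.prodMk_nhds hQ0)
    simpa [Function.comp_def] using h
  have hle : ∀ a, schwartzSeminormFamily 𝕜 (Fin (n + m) → E) 𝕜 (k, l')
      ((P a).appendTensor (Q a) - F.appendTensor G) ≤
        mulCompBound π₁ π₂ 1 k l' (P a - F) (Q a) + mulCompBound π₁ π₂ 1 k l' F (Q a - G) := by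
    intro a
    have hdec : (P a).appendTensor (Q a) - F.appendTensor G =
        (P a - F).appendTensor (Q a) + F.appendTensor (Q a - G) := by
      rw [appendTensor_sub_left, appendTensor_sub_right]; abel
    rw [schwartzSeminormFamily_apply, hdec]
    exact (map_add_le_add _ _ _).trans
      (add_le_add (seminorm_appendTensor_le _ _ k l') (seminorm_appendTensor_le _ _ k l'))
  filter_upwards [(hB₁.add hB₂).eventually (gt_mem_nhds (by simpa using hε))] with a ha
  exact (hle a).trans_lt ha

end AppendTensor

end SchwartzMap

namespace Literature.MathematicalPhysics.QuantumLattice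

/-! ### Tensor identities for the OS adjoint and the OS pairing -/

section OSPairing

variable {E : Type*} [NormedAddCommGroup E] [NormedSpace ℝ E]
variable {d : ℕ} [NeZero d] {n m : ℕ}

/-- The tensor product `F ⊗ G` (in appended variables) of two tensor products of one-point functions
is the tensor product of the appended family (`Fin.prod_univ_add`). [folklore] -/
theorem IsTensorOf.appendTensor {F : 𝓢((Fin n → E), ℂ)} {G : 𝓢((Fin m → E), ℂ)}
    {φ : Fin n → 𝓢(E, ℂ)} {ψ : Fin m → 𝓢(E, ℂ)} (hF : IsTensorOf F φ) (hG : IsTensorOf G ψ) :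
    IsTensorOf (F.appendTensor G) (Fin.append φ ψ) := by
  intro x
  rw [SchwartzMap.appendTensor_apply, hF, hG, Fin.prod_univ_add]
  simp

/-- Appending two families of complexified real test functions. [folklore] -/
theorem append_ofRealTest (f : Fin n → 𝓢(E, ℝ)) (g : Fin m → 𝓢(E, ℝ)) :
    Fin.append (fun i => ofRealTest (f i)) (fun j => ofRealTest (g j)) =
      fun k => ofRealTest (Fin.append f g k) := by
  funext k
  induction k using Fin.addCases with
  | left i => simp
  | right j => simp

/-- **The OS adjoint of a real tensor product** (OS 1973 §2, (2.4)):
`Θ(f₁ ⊗ ⋯ ⊗ fₙ)* = θf_n ⊗ ⋯ ⊗ θf₁` for real `fᵢ` (complex conjugation is trivial). [cite: OsterwalderSchraderCMP1973, §2 (2.4)] -/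
theorem IsTensorOf.osAdjoint {F : 𝓢((Fin n → EuclideanSpace ℝ (Fin d)), ℂ)}
    {f : Fin n → 𝓢(EuclideanSpace ℝ (Fin d), ℝ)} (hF : IsTensorOf F fun i => ofRealTest (f i)) :
    IsTensorOf (osAdjoint F) fun i => ofRealTest (thetaTest d (f (Fin.rev i))) := by
  intro x
  rw [osAdjoint_apply, hF]
  simp only [ofRealTest_apply, thetaTest_apply]
  rw [map_prod]
  simp only [Complex.conj_ofReal]
  exact Fintype.prod_equiv Fin.revPerm _ _ fun i => by simp

/-- The OS adjoint is additive. [folklore] -/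
theorem osAdjoint_add (F G : 𝓢((Fin n → EuclideanSpace ℝ (Fin d)), ℂ)) :
    osAdjoint (F + G) = osAdjoint F + osAdjoint G := by
  simp [osAdjoint]

/-- The OS adjoint is conjugate-homogeneous: `Θ(cF)* = c̄ ΘF*`. [folklore] -/
theorem osAdjoint_smul (c : ℂ) (F : 𝓢((Fin n → EuclideanSpace ℝ (Fin d)), ℂ)) :
    osAdjoint (c • F) = conj c • osAdjoint F := by
  ext x
  simp [osAdjoint_apply]

/-- The OS adjoint of a finite sum. [folklore] -/
theorem osAdjoint_sum {ι : Type*} (s : Finset ι)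
    (F : ι → 𝓢((Fin n → EuclideanSpace ℝ (Fin d)), ℂ)) :
    osAdjoint (∑ i ∈ s, F i) = ∑ i ∈ s, osAdjoint (F i) := by
  simp [osAdjoint, map_sum]

/-- The OS adjoint is continuous (composition of the continuous linear maps `starTest`,
`thetaMulti`, `permTest`). [folklore] -/
theorem continuous_osAdjoint :
    Continuous (osAdjoint : 𝓢((Fin n → EuclideanSpace ℝ (Fin d)), ℂ) → _) :=
  starTest.continuous.comp ((thetaMulti d).continuous.comp (permTest Fin.revPerm).continuous)

/-- The *OS pairing* of a Schwinger family: `⟪F, G⟫_S = 𝔖ₙ₊ₘ(ΘF* ⊗ G)` (OS 1973 (4.3), the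
sesquilinear form whose positivity is (E2)), with the concrete tensor product
`SchwartzMap.appendTensor`. [cite: OsterwalderSchraderCMP1973, §4.1 (4.3)] -/
def SchwingerFamily.osPairing (S : SchwingerFamily (EuclideanSpace ℝ (Fin d)))
    (F : 𝓢((Fin n → EuclideanSpace ℝ (Fin d)), ℂ)) (G : 𝓢((Fin m → EuclideanSpace ℝ (Fin d)), ℂ)) :
    ℂ :=
  S (n + m) ((osAdjoint F).appendTensor G)

/-- The OS pairing does not depend on the tensor-product witness. [folklore] -/
theorem SchwingerFamily.osPairing_eq_of_isAppendTensorOf (S : SchwingerFamily (EuclideanSpace ℝ (Fin d)))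
    {F : 𝓢((Fin n → EuclideanSpace ℝ (Fin d)), ℂ)} {G : 𝓢((Fin m → EuclideanSpace ℝ (Fin d)), ℂ)}
    {H : 𝓢((Fin (n + m) → EuclideanSpace ℝ (Fin d)), ℂ)} (hH : IsAppendTensorOf H (osAdjoint F) G) :
    S (n + m) H = S.osPairing F G := by
  rw [SchwingerFamily.osPairing]
  congr 1
  ext x
  rw [hH x, SchwartzMap.appendTensor_apply]

/-- Sesquilinearity of the OS pairing: finite sums with coefficients,
`⟪∑ᵢ aᵢFᵢ, ∑ⱼ bⱼGⱼ⟫ = ∑ᵢⱼ āᵢ bⱼ ⟪Fᵢ, Gⱼ⟫`. [folklore] -/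
theorem SchwingerFamily.osPairing_sum_smul (S : SchwingerFamily (EuclideanSpace ℝ (Fin d)))
    {ι κ : Type*} (s : Finset ι) (t : Finset κ) (a : ι → ℂ) (b : κ → ℂ)
    (F : ι → 𝓢((Fin n → EuclideanSpace ℝ (Fin d)), ℂ)) (G : κ → 𝓢((Fin m → EuclideanSpace ℝ (Fin d)), ℂ)) :
    S.osPairing (∑ i ∈ s, a i • F i) (∑ j ∈ t, b j • G j) =
      ∑ i ∈ s, ∑ j ∈ t, conj (a i) * b j * S.osPairing (F i) (G j) := by
  simp only [SchwingerFamily.osPairing, osAdjoint_sum, osAdjoint_smul,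
    SchwartzMap.appendTensor_sum_left, SchwartzMap.appendTensor_sum_right,
    SchwartzMap.appendTensor_smul_left, SchwartzMap.appendTensor_smul_right,
    map_sum (S (n + m)), (S (n + m)).map_smul, smul_eq_mul, Finset.smul_sum]
  rw [Finset.sum_comm]
  refine Finset.sum_congr rfl fun i _ => Finset.sum_congr rfl fun j _ => ?_
  ring

/-- Joint continuity of the OS pairing (from `tendsto_appendTensor` and continuity of `Θ(·)*` and
`𝔖ₙ₊ₘ`). [folklore] -/
theorem SchwingerFamily.tendsto_osPairing (S : SchwingerFamily (EuclideanSpace ℝ (Fin d)))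
    {α : Type*} {l : Filter α} {P : α → 𝓢((Fin n → EuclideanSpace ℝ (Fin d)), ℂ)}
    {Q : α → 𝓢((Fin m → EuclideanSpace ℝ (Fin d)), ℂ)}
    {F : 𝓢((Fin n → EuclideanSpace ℝ (Fin d)), ℂ)} {G : 𝓢((Fin m → EuclideanSpace ℝ (Fin d)), ℂ)}
    (hP : Tendsto P l (𝓝 F)) (hQ : Tendsto Q l (𝓝 G)) :
    Tendsto (fun a => S.osPairing (P a) (Q a)) l (𝓝 (S.osPairing F G)) :=
  ((S (n + m)).continuous.tendsto _).comp
    (SchwartzMap.tendsto_appendTensor ((continuous_osAdjoint.tendsto F).comp hP) hQ)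

/-- **The OS pairing of real tensor products is a moment** (GJ §6.1 (6.1.15); OS 1973 §4.1): for
the Schwinger family of `μ` and real `fᵢ`, `gⱼ`,
`⟪f₁ ⊗ ⋯ ⊗ fₙ, g₁ ⊗ ⋯ ⊗ gₘ⟫_S = ∫ (∏ᵢ ω(θfᵢ)) (∏ⱼ ω(gⱼ)) dμ(ω)`. [cite: GlimmJaffeQP1987, §6.1 (6.1.15)] -/
theorem IsSchwingerFamilyOf.osPairing_tensor {μ : Measure (FieldConfig (EuclideanSpace ℝ (Fin d)))}
    {S : SchwingerFamily (EuclideanSpace ℝ (Fin d))} (hS : IsSchwingerFamilyOf μ S)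
    {F : 𝓢((Fin n → EuclideanSpace ℝ (Fin d)), ℂ)} {G : 𝓢((Fin m → EuclideanSpace ℝ (Fin d)), ℂ)}
    {f : Fin n → 𝓢(EuclideanSpace ℝ (Fin d), ℝ)} {g : Fin m → 𝓢(EuclideanSpace ℝ (Fin d), ℝ)}
    (hF : IsTensorOf F fun i => ofRealTest (f i)) (hG : IsTensorOf G fun j => ofRealTest (g j)) :
    S.osPairing F G =
      ∫ ω, (∏ i, ((ω (thetaTest d (f i)) : ℝ) : ℂ)) * (∏ j, ((ω (g j) : ℝ) : ℂ)) ∂μ := by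
  have hT : IsTensorOf ((osAdjoint F).appendTensor G)
      fun k => ofRealTest (Fin.append (fun i => thetaTest d (f (Fin.rev i))) g k) := by
    rw [← append_ofRealTest]
    exact hF.osAdjoint.appendTensor hG
  rw [SchwingerFamily.osPairing, hS (n + m) _ _ hT, moment]
  rw [← integral_complex_ofReal]
  refine integral_congr_ae (ae_of_all _ fun ω => ?_)
  dsimp only
  rw [Fin.prod_univ_add]
  simp only [Fin.append_left, Fin.append_right, Complex.ofReal_mul, Complex.ofReal_prod]
  congr 1
  exact Fintype.prod_equiv Fin.revPerm _ _ fun i => by simp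

end OSPairing




/-! ### Reflection positivity E2 from OS3 and the density of positive-time tensor products -/

section E2

variable {E : Type*} [NormedAddCommGroup E] [NormedSpace ℝ E]
variable {d : ℕ} [NeZero d]

/-- Monomials `ω ↦ ∏ⱼ ω(hⱼ)` in the field are integrable when `μ` is finite with all moments
(`∏ⱼ |ω(hⱼ)| ≤ 1 + ∑ⱼ |ω(hⱼ)|^k`, `prod_le_one_add_sum_pow`; GJ §6.1, Prop. 6.1.4). [folklore] -/
theorem HasAllMoments.integrable_monomial {μ : Measure (FieldConfig E)} [IsFiniteMeasure μ]
    (hμ : HasAllMoments μ) {k : ℕ} (h : Fin k → 𝓢(E, ℝ)) :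
    Integrable (fun ω : FieldConfig E => ∏ j, ((ω (h j) : ℝ) : ℂ)) μ := by
  have hdom : Integrable (fun ω : FieldConfig E => (1 : ℝ) + ∑ j, |ω (h j)| ^ k) μ := by
    refine (integrable_const _).add (integrable_finsetSum _ fun j _ => ?_)
    have h' := (hμ ((k : ℕ) : NNReal) (h j)).integrable_norm_pow' (p := k)
    simpa [Real.norm_eq_abs] using h'
  refine hdom.mono' (continuous_monomial h).aestronglyMeasurable (ae_of_all _ fun ω => ?_)
  rw [norm_prod]
  simp only [Complex.norm_real, Real.norm_eq_abs]
  exact prod_le_one_add_sum_pow (fun j => |ω (h j)|) fun j => abs_nonneg _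

/-- The integrand of the OS pairing of two real tensor products, `(∏ᵢ ω(θfᵢ)) (∏ⱼ ω(gⱼ))`, is
integrable (a monomial in the appended family). [folklore] -/
theorem HasAllMoments.integrable_thetaMonomial_mul_monomial
    {μ : Measure (FieldConfig (EuclideanSpace ℝ (Fin d)))} [IsFiniteMeasure μ]
    (hμ : HasAllMoments μ) {k l : ℕ} (f : Fin k → 𝓢(EuclideanSpace ℝ (Fin d), ℝ))
    (g : Fin l → 𝓢(EuclideanSpace ℝ (Fin d), ℝ)) :
    Integrable (fun ω : FieldConfig (EuclideanSpace ℝ (Fin d)) =>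
      (∏ i, ((ω (thetaTest d (f i)) : ℝ) : ℂ)) * (∏ j, ((ω (g j) : ℝ) : ℂ))) μ := by
  have h := hμ.integrable_monomial (Fin.append (fun i => thetaTest d (f i)) g)
  refine h.congr (ae_of_all _ fun ω => ?_)
  simp only [Fin.prod_univ_add, Fin.append_left, Fin.append_right]

/-- **Positivity of the OS form on positive-time tensor data** (GJ §6.1 (6.1.8) + Prop. 6.1.4;
OS 1973 (4.3)): for the Schwinger family `S` of a probability measure `μ` with all moments and
OS3, and finitely many positive-time real tensor products `T_p = ⊗ⱼ φ_{pj}` with coefficients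
`c_p`, the double sum `∑_{p,q} c̄_p c_q 𝔖(ΘT_p* ⊗ T_q)` equals
`∫ conj (A(θω)) A(ω) dμ` for the field polynomial `A = ∑_p c_p ∏ⱼ ω(φ_{pj})`
(`osPairing_tensor`), hence is a nonnegative real by
`IsOS3ReflectionPositive.fieldPolynomial_nonneg`. [cite: GlimmJaffeQP1987, §6.1 (6.1.8) and Prop. 6.1.4] -/
theorem IsSchwingerFamilyOf.sum_sum_osPairing_nonneg
    {μ : Measure (FieldConfig (EuclideanSpace ℝ (Fin d)))} [IsFiniteMeasure μ]
    {S : SchwingerFamily (EuclideanSpace ℝ (Fin d))} (hS : IsSchwingerFamilyOf μ S)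
    (h3 : IsOS3ReflectionPositive d μ) (hμ : HasAllMoments μ)
    {ι : Type*} [Fintype ι] {deg : ι → ℕ} (c : ι → ℂ)
    (T : (p : ι) → 𝓢((Fin (deg p) → EuclideanSpace ℝ (Fin d)), ℂ))
    (φ : (p : ι) → Fin (deg p) → 𝓢(EuclideanSpace ℝ (Fin d), ℝ))
    (hφ : ∀ p j, IsPositiveTime (φ p j)) (hT : ∀ p, IsTensorOf (T p) fun j => ofRealTest (φ p j)) :
    let z := ∑ p, ∑ q, conj (c p) * c q * S.osPairing (T p) (T q)
    0 ≤ z.re ∧ z.im = 0 := by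
  intro z
  have hint : ∀ p q, Integrable (fun ω : FieldConfig (EuclideanSpace ℝ (Fin d)) =>
      (∏ i, ((ω (thetaTest d (φ p i)) : ℝ) : ℂ)) * (∏ j, ((ω (φ q j) : ℝ) : ℂ))) μ :=
    fun p q => hμ.integrable_thetaMonomial_mul_monomial _ _
  have hz : z = ∫ ω, conj (fieldPolynomial c φ (thetaField d ω)) * fieldPolynomial c φ ω ∂μ := by
    have hfun : (fun ω => conj (fieldPolynomial c φ (thetaField d ω)) * fieldPolynomial c φ ω) =
        fun ω => ∑ p, ∑ q, conj (c p) * c q *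
          ((∏ i, ((ω (thetaTest d (φ p i)) : ℝ) : ℂ)) * (∏ j, ((ω (φ q j) : ℝ) : ℂ))) := by
      funext ω
      simp only [fieldPolynomial, thetaField_apply, map_sum, map_mul, map_prod,
        Complex.conj_ofReal, Finset.sum_mul, Finset.mul_sum]
      rw [Finset.sum_comm]
      refine Finset.sum_congr rfl fun p _ => Finset.sum_congr rfl fun q _ => ?_
      ring
    rw [hfun, integral_finsetSum _ fun p _ =>
      integrable_finsetSum _ fun q _ => (hint p q).const_mul _]
    simp only [z]
    refine Finset.sum_congr rfl fun p _ => ?_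
    rw [integral_finsetSum _ fun q _ => (hint p q).const_mul _]
    refine Finset.sum_congr rfl fun q _ => ?_
    rw [integral_const_mul, hS.osPairing_tensor (hT p) (hT q)]
  rw [hz]
  exact h3.fieldPolynomial_nonneg hμ c φ hφ

/-- **E2 for the Schwinger functions of a measure with OS0 and OS3, from the density of
positive-time tensor products** (Glimm–Jaffe §6.1, (6.1.8) and Prop. 6.1.4, "OS3 on `𝒜₊`
extends to `𝓔₊`"; Osterwalder–Schrader 1973 §3 (E2) and §4.1 (4.3)). The OS form
`(F₀, …, F_N) ↦ ∑ₙₘ 𝔖ₙ₊ₘ(ΘFₙ* ⊗ Fₘ)` is continuous on `∏ₙ 𝓢(((ℝ^d)^n), ℂ)`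
(`tendsto_osPairing`) and takes nonnegative real values on tuples of finite combinations of
positive-time real tensor products (`sum_sum_osPairing_nonneg`, i.e. OS3 on field polynomials,
`IsOS3ReflectionPositive.fieldPolynomial_nonneg`, the moments existing by OS0); by density
(`IsPositiveTimeMulti.mem_closure_span_positiveTensorProducts`) and closedness of `[0, ∞) ⊆ ℂ`
it is a nonnegative real on all tuples of positive-time test functions, which is (E2) in the
witness form of `SchwingerFamily.IsOSReflectionPositive` (`osPairing_eq_of_isAppendTensorOf`).
Discharges `IsSchwingerFamilyOf.isOSReflectionPositive` modulo the density fact. [cite: GlimmJaffeQP1987, §6.1 (6.1.8) and Prop. 6.1.4] [cite: OsterwalderSchraderCMP1973, §3 (E2) and §4.1 (4.3)] -/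
theorem IsSchwingerFamilyOf.isOSReflectionPositive_of_closure
    (hD : IsPositiveTimeMulti.mem_closure_span_positiveTensorProducts (d := d)) :
    IsSchwingerFamilyOf.isOSReflectionPositive (d := d) := by
  intro μ _ S hS h0 h3 N F _ hFpos H hH z
  have hall : HasAllMoments μ := HasExponentialMoments.hasAllMoments_holds h0.1
  -- the OS form on the finite product of test function spaces, and its continuity
  let Φ : ((n : Fin (N + 1)) → 𝓢((Fin n → EuclideanSpace ℝ (Fin d)), ℂ)) → ℂ :=
    fun G => ∑ n, ∑ m, S.osPairing (G n) (G m)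
  have hΦ : Continuous Φ := by
    refine continuous_finsetSum _ fun n _ => continuous_finsetSum _ fun m _ => ?_
    exact continuous_iff_continuousAt.2 fun G =>
      S.tendsto_osPairing ((continuous_apply n).tendsto G) ((continuous_apply m).tendsto G)
  -- the closed set of nonnegative reals
  let C : Set ℂ := {w | 0 ≤ w.re ∧ w.im = 0}
  have hC : IsClosed C :=
    (isClosed_le continuous_const Complex.continuous_re).inter
      (isClosed_eq Complex.continuous_im continuous_const)
  -- positivity on tuples of finite combinations of positive-time tensor products
  let A : Set ((n : Fin (N + 1)) → 𝓢((Fin n → EuclideanSpace ℝ (Fin d)), ℂ)) :=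
    Set.pi Set.univ fun n => (Submodule.span ℂ (positiveTensorProducts (d := d) n) : Set _)
  have hA : A ⊆ Φ ⁻¹' C := by
    intro G hG
    have hrep : ∀ n : Fin (N + 1), ∃ (k : ℕ) (a : Fin k → ℂ)
        (v : Fin k → positiveTensorProducts (d := d) n),
        ∑ i, a i • (v i : 𝓢((Fin n → EuclideanSpace ℝ (Fin d)), ℂ)) = G n :=
      fun n => Submodule.mem_span_set'.1 (hG n (Set.mem_univ n))
    choose k a v hv using hrep
    have hv' : ∀ (n : Fin (N + 1)) (i : Fin (k n)),
        ∃ f : Fin n → 𝓢(EuclideanSpace ℝ (Fin d), ℝ), (∀ j, IsPositiveTime (f j)) ∧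
          IsTensorOf (v n i : 𝓢((Fin n → EuclideanSpace ℝ (Fin d)), ℂ))
            fun j => ofRealTest (f j) :=
      fun n i => (v n i).2
    choose f hf hT using hv'
    have key := hS.sum_sum_osPairing_nonneg h3 hall (ι := Σ n : Fin (N + 1), Fin (k n))
      (deg := fun p => (p.1 : ℕ)) (fun p => a p.1 p.2)
      (fun p => (v p.1 p.2 : 𝓢((Fin p.1 → EuclideanSpace ℝ (Fin d)), ℂ)))
      (fun p => f p.1 p.2) (fun p j => hf p.1 p.2 j) (fun p => hT p.1 p.2)
    have hΦG : Φ G = ∑ p : (Σ n : Fin (N + 1), Fin (k n)), ∑ q : (Σ n : Fin (N + 1), Fin (k n)),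
        conj (a p.1 p.2) * a q.1 q.2 *
          S.osPairing (v p.1 p.2 : 𝓢((Fin p.1 → EuclideanSpace ℝ (Fin d)), ℂ))
            (v q.1 q.2 : 𝓢((Fin q.1 → EuclideanSpace ℝ (Fin d)), ℂ)) := by
      simp only [Φ, ← hv]
      simp only [Fintype.sum_sigma]  -- may need name fix
      refine Finset.sum_congr rfl fun n _ => ?_
      rw [Finset.sum_comm]
      refine Finset.sum_congr rfl fun m _ => ?_
      have := S.osPairing_sum_smul Finset.univ Finset.univ (a n) (a m)
        (fun i => (v n i : 𝓢((Fin n → EuclideanSpace ℝ (Fin d)), ℂ)))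
        (fun i => (v m i : 𝓢((Fin m → EuclideanSpace ℝ (Fin d)), ℂ)))
      rw [this]
    show Φ G ∈ C
    rw [hΦG]
    exact key
  -- closure
  have hcl : closure A ⊆ Φ ⁻¹' C := (hC.preimage hΦ).closure_subset_iff.2 hA
  have hFmem : (fun n : Fin (N + 1) => F n) ∈ closure A := by
    rw [closure_pi_set]
    exact fun n _ => hD n (F n) (hFpos n)
  have hres : Φ (fun n : Fin (N + 1) => F n) ∈ C := hcl hFmem
  -- identification of the E2 double sum with the OS form
  have hz : (∑ n ∈ Finset.range (N + 1), ∑ m ∈ Finset.range (N + 1), S (n + m) (H n m)) =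
      Φ (fun n : Fin (N + 1) => F n) := by
    simp only [Φ]
    rw [Finset.sum_range (fun n => ∑ m ∈ Finset.range (N + 1), S (n + m) (H n m))]
    refine Finset.sum_congr rfl fun n _ => ?_
    rw [Finset.sum_range (fun m => S (n + m) (H n m))]
    refine Finset.sum_congr rfl fun m _ => ?_
    exact S.osPairing_eq_of_isAppendTensorOf (hH n m)
  show (∑ n ∈ Finset.range (N + 1), ∑ m ∈ Finset.range (N + 1), S (n + m) (H n m)) ∈ C
  rw [hz]
  exact hres

end E2

end Literature.MathematicalPhysics.QuantumLattice
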